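import Mathlib.RingTheory.Polynomial.GaussLemma
import Mathlib.RingTheory.Localization.Integral
import Mathlib.RingTheory.Algebraic.Basic
import Summits.Schanuel.Schanuel.Theorems.SoloInformedBoxExact

/-!
# Proposition BF — the relation ideal of a pair with a transcendental coordinate is principal;
# the box dichotomy at `(e, π)` without hypotheses

Solo programme `solo-Schanuel-informed` (verdict NO PATH unchanged; this file discharges the one
hypothesis of Proposition BE, `SoloInformedBoxExact.expOnePi_box_dichotomy_of_principal`, by
standard commutative algebra: "typed and measured, not a mechanism").

## Statements (all sorry-free)

* §1 (GCD domains) `exists_ker_eq_span_singleton_of_comp_C_injective`: let `R` be a GCD domain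
  (`NormalizedGCDMonoid R`) with fraction field `K`, `L` a field and `Φ : R[Y] →+* L` a ring map
  whose restriction to the constants `R` is injective.  Then `ker Φ = (P)` for some `P ∈ R[Y]`.
  Proof: over `K` the kernel of the extended map `K[Y] → L` is `(m)` (`K[Y]` is a PID); if
  `m = 0` the kernel over `R` is `0`; otherwise clear denominators (`integerNormalization`) and
  take the primitive part `P`; a relation `Q ∈ R[Y]` is divisible by `P` over `K`, hence over `R`
  by Gauss's lemma (Mathlib `Polynomial.IsPrimitive.dvd_of_fraction_map_dvd_fraction_map`).
* §2 (two variables) the dictionary `k[X₀, X₁] ≃ k[X][Y]` (`X 0 ↦ Y`, `X 1 ↦ X`; local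
  notations `toBiv[k]`, `ofBiv[k]` for Mathlib `aeval` terms — this file declares no
  definitions) and `ker_aeval_isPrincipal_of_transcendental_snd/_fst/(no suffix)`: for a field
  `k`, a field extension `L` and `v : Fin 2 → L` with ONE transcendental coordinate, the ideal
  of algebraic relations `ker (Q ↦ Q(v)) ⊂ k[X₀, X₁]` is principal.
* §3 (the point `(e, π)`) `relationIdeal_isPrincipal` (either coordinate transcendental),
  `relationIdeal_expOnePi_isPrincipal`, and **Proposition BF** `expOnePi_box_dichotomy`:
  EITHER `e` and `π` are algebraically independent over `ℚ`, OR there are `a, b ≥ 1` with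
  `BilinearFloor ⟺ max(a,b) ≥ 2` and `dim_ℚ ⟨Box_d(e, π)⟩ = (a + b)(d + 1) − ab` for every
  `d ≥ max(a, b)` — Proposition BE with its principality hypothesis removed.

## Reading

This is the textbook fact "a prime of `k[X, Y]` meeting `k[X]` trivially is `0` or principal"
(height `≤ 1` in a UFD), proved here along the Gauss-lemma route rather than via Krull dimension.
It changes no verdict: which branch of the dichotomy holds at `(e, π)` is exactly the open
question of the algebraic independence of `e` and `π` (a consequence of Schanuel's conjecture).

## References

* [Matsumura1986] H. Matsumura, *Commutative Ring Theory*, CUP 1986, Thm 20.1 and Ex. 20.4.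
* [Nesterenko1985] Yu. V. Nesterenko, *On the linear independence of numbers*, Moscow Univ.
  Math. Bull. 40 (1985), 69–74.
-/

noncomputable section

open Literature.NumberTheory.Transcendental (ExpOnePiAlgebraicIndependent transcendental_exp_one
  transcendental_pi transcendental_exp_one_holds transcendental_pi_holds)

namespace Summit.Schanuel.Schanuel.Theorems

/-! ### §1 Relation ideals over a GCD domain are principal -/

section GCDDomain

variable {R L : Type*} [CommRing R] [IsDomain R] [NormalizedGCDMonoid R] [Field L]

/-- **Relations of one element over a GCD domain form a principal ideal** (auxiliary form with
a chosen fraction field `K` of `R`).  Let `R` be a GCD domain, `L` a field and `Φ : R[Y] →+* L`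
a ring homomorphism that is injective on the constants.  Then `ker Φ = (P)` for some `P ∈ R[Y]`
(namely `P = 0` if `Φ` is injective, and otherwise the primitive part of a cleared-denominator
generator of the kernel of the extension `K[Y] → L`; Gauss's lemma brings divisibility back
from `K[Y]` to `R[Y]`). -/
theorem exists_ker_eq_span_singleton_of_comp_C_injective_aux (K : Type*) [Field K]
    [Algebra R K] [IsFractionRing R K] (Φ : Polynomial R →+* L)
    (hΦ : Function.Injective (Φ.comp Polynomial.C)) :
    ∃ P : Polynomial R, RingHom.ker Φ = Ideal.span {P} := by
  -- `Φ` is evaluation at `y := Φ(Y)` with coefficients mapped by `φ := Φ ∘ C`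
  set φ : R →+* L := Φ.comp Polynomial.C with hφdef
  have hΦφ : Φ = Polynomial.eval₂RingHom φ (Φ Polynomial.X) :=
    Polynomial.ringHom_ext (fun a => by simp [hφdef]) (by simp)
  have hΦ_eq : ∀ Q : Polynomial R, Φ Q = Polynomial.eval₂ φ (Φ Polynomial.X) Q := fun Q =>
    RingHom.congr_fun hΦφ Q
  have hRK : Function.Injective (algebraMap R K) := IsFractionRing.injective R K
  -- extend `φ` to the fraction field and `Φ` to `K[Y]`
  let ψ : K →+* L := IsFractionRing.lift hΦ
  have hψ : ∀ a : R, ψ (algebraMap R K a) = φ a := fun a => IsFractionRing.lift_algebraMap hΦ a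
  let Ψ : Polynomial K →+* L := Polynomial.eval₂RingHom ψ (Φ Polynomial.X)
  have hcomp : ∀ Q : Polynomial R, Ψ (Q.map (algebraMap R K)) = Φ Q := by
    intro Q
    rw [hΦ_eq Q]
    simp only [Ψ, Polynomial.coe_eval₂RingHom, Polynomial.eval₂_map]
    congr 1
    exact RingHom.ext hψ
  -- `K[Y]` is a principal ideal domain
  obtain ⟨m, hm⟩ := Submodule.IsPrincipal.principal (RingHom.ker Ψ)
  have hmemK : ∀ F : Polynomial K, Ψ F = 0 ↔ m ∣ F := fun F => by
    have h1 : F ∈ RingHom.ker Ψ ↔ m ∣ F := by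
      rw [hm]
      exact Ideal.mem_span_singleton
    rwa [RingHom.mem_ker] at h1
  by_cases hm0 : m = 0
  · -- `Φ` is injective: the kernel is `(0)`
    refine ⟨0, ?_⟩
    ext Q
    rw [RingHom.mem_ker, Ideal.mem_span_singleton, zero_dvd_iff, ← hcomp, hmemK, hm0,
      zero_dvd_iff]
    exact Polynomial.map_eq_zero_iff hRK
  · -- clear denominators: `P₁ ∈ R[Y]` with `P₁ = C(b) · m` over `K`, `b ≠ 0`
    obtain ⟨b, hb, hbm⟩ := IsLocalization.integerNormalization_spec (nonZeroDivisors R) m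
    set P₁ : Polynomial R := IsLocalization.integerNormalization (nonZeroDivisors R) m with hP₁def
    rw [Algebra.smul_def, Polynomial.algebraMap_apply] at hbm
    have hb0 : IsUnit (Polynomial.C (algebraMap R K b)) :=
      Polynomial.isUnit_C.mpr (Ne.isUnit fun h =>
        nonZeroDivisors.ne_zero hb ((injective_iff_map_eq_zero _).mp hRK b h))
    have hP₁0 : P₁ ≠ 0 := by
      intro h
      rw [h, Polynomial.map_zero] at hbm
      exact hm0 (hb0.mul_right_eq_zero.mp hbm.symm)
    -- the primitive part `P` of `P₁` generates the kernel of `Ψ` over `K` as well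
    have hc0 : IsUnit (Polynomial.C (algebraMap R K P₁.content)) :=
      Polynomial.isUnit_C.mpr (Ne.isUnit fun h =>
        (mt Polynomial.content_eq_zero_iff.mp hP₁0) ((injective_iff_map_eq_zero _).mp hRK _ h))
    have hP₁map : P₁.map (algebraMap R K) =
        Polynomial.C (algebraMap R K P₁.content) * P₁.primPart.map (algebraMap R K) := by
      conv_lhs => rw [P₁.eq_C_content_mul_primPart]
      rw [Polynomial.map_mul, Polynomial.map_C]
    have hdvd : ∀ F : Polynomial K, m ∣ F ↔ P₁.primPart.map (algebraMap R K) ∣ F := fun F => by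
      have h1 : m ∣ F ↔ P₁.map (algebraMap R K) ∣ F := by
        rw [hbm, hb0.mul_left_dvd]
      have h2 : P₁.map (algebraMap R K) ∣ F ↔ P₁.primPart.map (algebraMap R K) ∣ F := by
        rw [hP₁map, hc0.mul_left_dvd]
      exact h1.trans h2
    -- Gauss's lemma: divisibility by the primitive `P` descends from `K[Y]` to `R[Y]`
    refine ⟨P₁.primPart, ?_⟩
    ext Q
    rw [RingHom.mem_ker, Ideal.mem_span_singleton, ← hcomp, hmemK, hdvd]
    constructor
    · exact fun h => (Polynomial.isPrimitive_primPart P₁).dvd_of_fraction_map_dvd_fraction_map h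
    · exact fun h => Polynomial.map_dvd (algebraMap R K) h

/-- **Relations of one element over a GCD domain form a principal ideal** (the statement of
`exists_ker_eq_span_singleton_of_comp_C_injective_aux` with the fraction field `FractionRing R`
chosen): if `Φ : R[Y] →+* L` is injective on the constants then `ker Φ = (P)` for some `P`. -/
theorem exists_ker_eq_span_singleton_of_comp_C_injective (Φ : Polynomial R →+* L)
    (hΦ : Function.Injective (Φ.comp Polynomial.C)) :
    ∃ P : Polynomial R, RingHom.ker Φ = Ideal.span {P} :=
  exists_ker_eq_span_singleton_of_comp_C_injective_aux (FractionRing R) Φ hΦ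

/-- The principal-ideal form of `exists_ker_eq_span_singleton_of_comp_C_injective`. -/
theorem ker_isPrincipal_of_comp_C_injective (Φ : Polynomial R →+* L)
    (hΦ : Function.Injective (Φ.comp Polynomial.C)) : (RingHom.ker Φ).IsPrincipal := by
  obtain ⟨P, hP⟩ := exists_ker_eq_span_singleton_of_comp_C_injective Φ hΦ
  exact ⟨P, hP⟩

end GCDDomain

/-! ### §2 Two variables: `k[X₀, X₁] ≃ k[X][Y]` and relation ideals of pairs -/

section Bivariate

variable (k : Type*) [Field k]

/-- The dictionary `k[X₀, X₁] → k[X][Y]`: `X 0 ↦ Y` (the outer variable) and `X 1 ↦ X` (the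
variable of the coefficient ring `k[X]`).  Local notation for a Mathlib term — no new
declaration. -/
local notation "toBiv[" k "]" =>
  (MvPolynomial.aeval ![Polynomial.X, Polynomial.C Polynomial.X] :
    MvPolynomial (Fin 2) k →ₐ[k] Polynomial (Polynomial k))

/-- The inverse dictionary `k[X][Y] → k[X₀, X₁]`: a coefficient `p(X)` goes to `p(X 1)` and `Y`
to `X 0`.  Local notation for a Mathlib term — no new declaration. -/
local notation "ofBiv[" k "]" =>
  (Polynomial.aevalTower (Polynomial.aeval (MvPolynomial.X 1 : MvPolynomial (Fin 2) k))
      (MvPolynomial.X 0 : MvPolynomial (Fin 2) k) :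
    Polynomial (Polynomial k) →ₐ[k] MvPolynomial (Fin 2) k)

/-- `ofBiv ∘ toBiv = id` on `k[X₀, X₁]`. -/
theorem ofBivariate_toBivariate (Q : MvPolynomial (Fin 2) k) : ofBiv[k] (toBiv[k] Q) = Q := by
  have h : (ofBiv[k]).comp (toBiv[k]) = AlgHom.id k (MvPolynomial (Fin 2) k) :=
    MvPolynomial.algHom_ext (Fin.forall_fin_two.mpr ⟨by simp, by simp⟩)
  exact DFunLike.congr_fun h Q

/-- `toBiv ∘ ofBiv = id` on `k[X][Y]`. -/
theorem toBivariate_ofBivariate (F : Polynomial (Polynomial k)) : toBiv[k] (ofBiv[k] F) = F := by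
  have h : (toBiv[k]).comp (ofBiv[k]) = AlgHom.id k (Polynomial (Polynomial k)) :=
    Polynomial.algHom_ext' (Polynomial.algHom_ext (by simp)) (by simp)
  exact DFunLike.congr_fun h F

variable {L : Type*} [Field L] [Algebra k L]

/-- Evaluating `Q ∈ k[X₀, X₁]` at `v` is evaluating its bivariate form at `Y ↦ v 0`, `X ↦ v 1`. -/
theorem aeval_eq_aevalTower_toBivariate (v : Fin 2 → L) (Q : MvPolynomial (Fin 2) k) :
    MvPolynomial.aeval v Q =
      (Polynomial.aevalTower (Polynomial.aeval (v 1)) (v 0) : Polynomial (Polynomial k) →ₐ[k] L)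
        (toBiv[k] Q) := by
  have h : (MvPolynomial.aeval v : MvPolynomial (Fin 2) k →ₐ[k] L) =
      (Polynomial.aevalTower (Polynomial.aeval (v 1)) (v 0) :
        Polynomial (Polynomial k) →ₐ[k] L).comp (toBiv[k]) :=
    MvPolynomial.algHom_ext (Fin.forall_fin_two.mpr ⟨by simp, by simp⟩)
  exact DFunLike.congr_fun h Q

/-- If `v 1` is transcendental over `k`, the bivariate evaluation at `v` is injective on the
coefficient ring `k[X]`. -/
theorem aevalTower_comp_C_injective_of_transcendental {v : Fin 2 → L}
    (hv : Transcendental k (v 1)) :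
    Function.Injective
      (((Polynomial.aevalTower (Polynomial.aeval (v 1)) (v 0) :
          Polynomial (Polynomial k) →ₐ[k] L) : Polynomial (Polynomial k) →+* L).comp
        Polynomial.C) := by
  intro a b hab
  apply transcendental_iff_injective.mp hv
  simpa using hab

/-- **The relation ideal of a pair with transcendental second coordinate is principal.**  For a
field `k`, a field `L ⊇ k` and `v : Fin 2 → L` with `v 1` transcendental over `k`, the ideal
`{Q ∈ k[X₀, X₁] : Q(v) = 0}` is principal. -/
theorem ker_aeval_isPrincipal_of_transcendental_snd (v : Fin 2 → L)
    (hv : Transcendental k (v 1)) :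
    (RingHom.ker (MvPolynomial.aeval v : MvPolynomial (Fin 2) k →ₐ[k] L)).IsPrincipal := by
  classical
  obtain ⟨P, hP⟩ := exists_ker_eq_span_singleton_of_comp_C_injective
    ((Polynomial.aevalTower (Polynomial.aeval (v 1)) (v 0) :
        Polynomial (Polynomial k) →ₐ[k] L) : Polynomial (Polynomial k) →+* L)
    (aevalTower_comp_C_injective_of_transcendental k hv)
  have hmem : ∀ F : Polynomial (Polynomial k),
      (Polynomial.aevalTower (Polynomial.aeval (v 1)) (v 0) :
          Polynomial (Polynomial k) →ₐ[k] L) F = 0 ↔ P ∣ F := fun F => by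
    have h1 : F ∈ RingHom.ker ((Polynomial.aevalTower (Polynomial.aeval (v 1)) (v 0) :
        Polynomial (Polynomial k) →ₐ[k] L) : Polynomial (Polynomial k) →+* L) ↔ P ∣ F := by
      rw [hP]
      exact Ideal.mem_span_singleton
    simpa using h1
  refine ⟨ofBiv[k] P, ?_⟩
  ext Q
  change _ ↔ Q ∈ Ideal.span {ofBiv[k] P}
  rw [RingHom.mem_ker, Ideal.mem_span_singleton, aeval_eq_aevalTower_toBivariate, hmem]
  constructor
  · intro h
    have h' := map_dvd (ofBiv[k]) h
    rwa [ofBivariate_toBivariate] at h'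
  · intro h
    have h' := map_dvd (toBiv[k]) h
    rwa [toBivariate_ofBivariate] at h'

/-- **The relation ideal of a pair with transcendental first coordinate is principal** (from
the previous statement by swapping the variables). -/
theorem ker_aeval_isPrincipal_of_transcendental_fst (v : Fin 2 → L)
    (hv : Transcendental k (v 0)) :
    (RingHom.ker (MvPolynomial.aeval v : MvPolynomial (Fin 2) k →ₐ[k] L)).IsPrincipal := by
  set σ : Fin 2 ≃ Fin 2 := Equiv.swap 0 1 with hσ
  have hσσ : ∀ i : Fin 2, σ (σ i) = i := fun i => Equiv.swap_apply_self _ _ _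
  have hv' : Transcendental k ((v ∘ σ) 1) := by simpa [hσ] using hv
  haveI := ker_aeval_isPrincipal_of_transcendental_snd k (v ∘ σ) hv'
  obtain ⟨P, hP⟩ := Submodule.IsPrincipal.principal
    (RingHom.ker (MvPolynomial.aeval (v ∘ σ) : MvPolynomial (Fin 2) k →ₐ[k] L))
  have hmem : ∀ Q : MvPolynomial (Fin 2) k, MvPolynomial.aeval (v ∘ σ) Q = 0 ↔ P ∣ Q :=
    fun Q => by
      have h1 : Q ∈ RingHom.ker (MvPolynomial.aeval (v ∘ σ) : MvPolynomial (Fin 2) k →ₐ[k] L) ↔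
          P ∣ Q := by
        rw [hP]
        exact Ideal.mem_span_singleton
      rwa [RingHom.mem_ker] at h1
  have hvσ : (v ∘ σ) ∘ σ = v := funext fun i => by simp [hσσ i]
  have hrr : ∀ Q : MvPolynomial (Fin 2) k,
      MvPolynomial.rename σ (MvPolynomial.rename σ Q) = Q := fun Q => by
    have hid : ((σ : Fin 2 → Fin 2) ∘ σ) = id := funext hσσ
    rw [MvPolynomial.rename_rename, hid]
    exact DFunLike.congr_fun MvPolynomial.rename_id Q
  have haev : ∀ Q : MvPolynomial (Fin 2) k,
      MvPolynomial.aeval v Q = MvPolynomial.aeval (v ∘ σ) (MvPolynomial.rename σ Q) := fun Q => by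
    rw [MvPolynomial.aeval_rename, hvσ]
  refine ⟨MvPolynomial.rename σ P, ?_⟩
  ext Q
  change _ ↔ Q ∈ Ideal.span {MvPolynomial.rename σ P}
  rw [RingHom.mem_ker, Ideal.mem_span_singleton, haev, hmem]
  constructor
  · intro h
    have h' := map_dvd (MvPolynomial.rename σ : MvPolynomial (Fin 2) k →ₐ[k] _) h
    rwa [hrr] at h'
  · intro h
    have h' := map_dvd (MvPolynomial.rename σ : MvPolynomial (Fin 2) k →ₐ[k] _) h
    rwa [hrr] at h'

/-- **One transcendental coordinate suffices.** -/
theorem ker_aeval_isPrincipal_of_transcendental (v : Fin 2 → L)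
    (hv : Transcendental k (v 0) ∨ Transcendental k (v 1)) :
    (RingHom.ker (MvPolynomial.aeval v : MvPolynomial (Fin 2) k →ₐ[k] L)).IsPrincipal :=
  hv.elim (ker_aeval_isPrincipal_of_transcendental_fst k v)
    (ker_aeval_isPrincipal_of_transcendental_snd k v)

end Bivariate

/-! ### §3 The relation ideal of `(e, π)` and Proposition BF -/

/-- **The relation ideal of a point of `ℝ²` with a transcendental coordinate is principal.** -/
theorem relationIdeal_isPrincipal {x : Fin 2 → ℝ}
    (hx : Transcendental ℚ (x 0) ∨ Transcendental ℚ (x 1)) : (relationIdeal x).IsPrincipal :=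
  ker_aeval_isPrincipal_of_transcendental ℚ x hx

/-- **The relation ideal of `(e, π)` over `ℚ` is principal** (`π` is transcendental). -/
theorem relationIdeal_expOnePi_isPrincipal :
    (relationIdeal ![Real.exp 1, Real.pi]).IsPrincipal := by
  have hpi : Transcendental ℚ Real.pi := transcendental_pi_holds
  exact relationIdeal_isPrincipal (Or.inr (by simpa using hpi))

/-- **Proposition BF — the quantised ladder at `(e, π)`, unconditionally.**  EITHER `e` and `π`
are algebraically independent over `ℚ` (every box `Box_d(e, π)` is `ℚ`-free), OR there are
`a, b ≥ 1` — the bidegree of a generator of the relation ideal — with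
`BilinearFloor ⟺ max(a,b) ≥ 2` and `dim_ℚ ⟨Box_d(e, π)⟩ = (a + b)(d + 1) − ab` for every
`d ≥ max(a, b)`.  (Proposition BE with its principality hypothesis discharged by
`relationIdeal_expOnePi_isPrincipal`; which branch holds is the open question of the algebraic
independence of `e` and `π`.) -/
theorem expOnePi_box_dichotomy :
    ExpOnePiAlgebraicIndependent ∨
      ∃ a b : ℕ, 1 ≤ a ∧ 1 ≤ b ∧ (BilinearFloor ↔ 2 ≤ max a b) ∧
        ∀ d : ℕ, max a b ≤ d →
          Module.finrank ℚ
              (Submodule.span ℚ (Set.range (boxMonomial ![Real.exp 1, Real.pi] d))) =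
            (a + b) * (d + 1) - a * b :=
  expOnePi_box_dichotomy_of_principal relationIdeal_expOnePi_isPrincipal

end Summit.Schanuel.Schanuel.Theorems

end
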